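import Summits.ABC.IUTFork.Repair.RHHullCapacityNecessaryAnti
import HarnessLib

/-!
# R-H row 3 «hull-capacity-necessary» — `RHHullCapacityNecessaryAntiTight`: the width dichotomy behind the ANTITONE law of p479453 is LOAD-BEARING,
# and two hypotheses of its §1 engine are REDUNDANT

PROOF-ONLY leaf file of the abc-iut cell (D-0079 RESCUE sub-cell R-H, rung LADDER-ABC:A2.RESCUE.H). Content AUTHORED by the row-3 TESTER
abc-iut-rh-tst-3 (gen 6; tester evidence `HOME/abc-iut-rh-tst-3/gen6/row3_anti_k3.out` PART 4, offered block `staging/RH/abc-iut-rh-tst-3/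
AntiWidthTight.append-block.lean`), FILED by the row-3 typer lineage abc-iut-rh-typ-3 (gen 8) — refuter seats do not file under `Repair/`. TAKES NO
SIDE on [IUTchIII] Cor. 3.12 or on any author; nothing here asserts abc; every statement below is elementary real arithmetic about the floor-cell
shape `⌊j²μ − (j+1)δ⌋ ≤ μ + (j+1)β` of `RHHullCapacityNecessaryTyped.cellAt_iff_floor_le` (p458118), read BY NAME from
`RHHullCapacityNecessaryAnti` §1 (`lt_floor_of_lt_floor`, `sqSubOne_mul_le_of_le`, p479453).

WHY THIS FILE. `RHHullCapacityNecessaryAnti.cellAt_anti` (the [ED] cell is antitone in the label at EVERY place of EVERY pilot datum, no local-type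
hypothesis) rests on ONE structural input: print's width `β = c + b` lies in `{0} ∪ [1/2, ∞)` (`depthWidth_zero_or_half_le`). This file records
that the input is not decoration: (1) **`floorCell_not_anti_of_width_sixth`** — with a width in the excluded window (`β = 1/6`, `μ = 1/15`, `δ = 0`)
the floor-cell FAILS at `j = 4` and HOLDS at `j = 5`, i.e. is NOT antitone; (2) **`not_lt_floor_of_lt_floor_of_nonneg_width`** — §1's propagation
lemma with the width hypothesis weakened to `0 ≤ β` is FALSE (same witness); and two hygiene facts: (3) **`lt_floor_of_lt_floor'`** — the
hypothesis `0 ≤ μ` of `lt_floor_of_lt_floor` is redundant (for `μ < 0` the failing-cell premise is unsatisfiable); (4) **`sqSubOne_mul_le_of_le'`**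
— the hypothesis `1 ≤ j₁` of `sqSubOne_mul_le_of_le` is redundant. Tester table of record: for EVERY `β = k/1000 ∈ (0, 1/2)` a non-antitone
triple exists (499/499, windows `(m, j ≈ 2m+1)`). PROOF-ONLY (0 defs). [folklore] for all four (elementary); the IUT locutions in this docstring
are [claim: Mochizuki2012, status: disputed]. typed ≠ proved; locator ≠ «S holds».
-/

noncomputable section

namespace Summit.ABC.IUTFork.Repair.RHHullCapacityNecessaryAntiTight

open Summit.ABC.IUTFork.Repair.RHHullCapacityNecessaryAnti

/-! ## §1. The width dichotomy `β ∈ {0} ∪ [1/2, ∞)` of `lt_floor_of_lt_floor` is load-bearing -/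

/-- **THE WIDTH DICHOTOMY `β ∈ {0} ∪ [1/2, ∞)` IS LOAD-BEARING.** With a width in the excluded window — `β = 1/6` — and `μ = 1/15`, `δ = 0`, the
floor-cell `⌊j²μ − (j+1)δ⌋ ≤ μ + (j+1)β` FAILS at `j = 4` (`9/10 < ⌊16/15⌋ = 1`) yet HOLDS at `j = 5` (`⌊25/15⌋ = 1 ≤ 16/15`): NOT antitone in the
label. For EVERY `β ∈ (0, 1/2)` such a triple exists (tester table HOME/abc-iut-rh-tst-3/gen6/row3_anti_k3.out PART 4: 499/499 on the grid
`β = k/1000`, windows `(m, j ≈ 2m+1)`); print's width `c + b` never lies in that window (`depthWidth_zero_or_half_le`). [folklore] -/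
theorem floorCell_not_anti_of_width_sixth :
    ¬ ((⌊(4 : ℝ) ^ 2 * (1 / 15 : ℝ) - (4 + 1) * (0 : ℝ)⌋ : ℝ) ≤ 1 / 15 + (4 + 1) * (1 / 6 : ℝ)) ∧
      (⌊(5 : ℝ) ^ 2 * (1 / 15 : ℝ) - (5 + 1) * (0 : ℝ)⌋ : ℝ) ≤ 1 / 15 + (5 + 1) * (1 / 6 : ℝ) := by
  have h4 : ⌊(4 : ℝ) ^ 2 * (1 / 15 : ℝ) - (4 + 1) * (0 : ℝ)⌋ = 1 := by rw [Int.floor_eq_iff]; norm_num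
  have h5 : ⌊(5 : ℝ) ^ 2 * (1 / 15 : ℝ) - (5 + 1) * (0 : ℝ)⌋ = 1 := by rw [Int.floor_eq_iff]; norm_num
  rw [h4, h5]; norm_num

/-- `lt_floor_of_lt_floor` with its width hypothesis weakened to `0 ≤ β` is FALSE (witness `μ = 1/15`, `δ = 0`, `β = 1/6`, `j = 4`, `n = 1`). [folklore] -/
theorem not_lt_floor_of_lt_floor_of_nonneg_width : ¬ ∀ (μ δ β : ℝ), 0 ≤ μ → 0 ≤ δ → 0 ≤ β → ∀ (j : ℕ), 2 ≤ j → ∀ (n : ℕ),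
    μ + ((j : ℝ) + 1) * β < (⌊(j : ℝ) ^ 2 * μ - ((j : ℝ) + 1) * δ⌋ : ℝ) →
      μ + ((j : ℝ) + n + 1) * β < (⌊((j : ℝ) + n) ^ 2 * μ - ((j : ℝ) + n + 1) * δ⌋ : ℝ) := by
  intro h
  have hf4 : ⌊((4 : ℕ) : ℝ) ^ 2 * (1 / 15 : ℝ) - (((4 : ℕ) : ℝ) + 1) * 0⌋ = 1 := by rw [Int.floor_eq_iff]; norm_num
  have hf5 : ⌊(((4 : ℕ) : ℝ) + ((1 : ℕ) : ℝ)) ^ 2 * (1 / 15 : ℝ) - (((4 : ℕ) : ℝ) + ((1 : ℕ) : ℝ) + 1) * 0⌋ = 1 := by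
    rw [Int.floor_eq_iff]; norm_num
  have h1 := h (1 / 15) 0 (1 / 6) (by norm_num) le_rfl (by norm_num) 4 (by norm_num) 1 (by rw [hf4]; norm_num)
  rw [hf5] at h1
  norm_num at h1

/-! ## §2. Two hypotheses of `RHHullCapacityNecessaryAnti` §1 are redundant -/

/-- `lt_floor_of_lt_floor` WITHOUT `0 ≤ μ`: for `μ < 0` the failing-cell hypothesis is unsatisfiable (`j²μ ≤ μ`, `δ, β ≥ 0`). [folklore] -/
theorem lt_floor_of_lt_floor' {μ δ β : ℝ} (hδ : 0 ≤ δ) (hβ : β = 0 ∨ 1 / 2 ≤ β) {j : ℕ} (hj : 2 ≤ j) (n : ℕ)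
    (h : μ + ((j : ℝ) + 1) * β < (⌊(j : ℝ) ^ 2 * μ - ((j : ℝ) + 1) * δ⌋ : ℝ)) :
    μ + ((j : ℝ) + n + 1) * β < (⌊((j : ℝ) + n) ^ 2 * μ - ((j : ℝ) + n + 1) * δ⌋ : ℝ) := by
  by_cases hμ : 0 ≤ μ
  · exact lt_floor_of_lt_floor hμ hδ hβ hj n h
  · exfalso
    rw [not_le] at hμ
    have hfl := Int.floor_le ((j : ℝ) ^ 2 * μ - ((j : ℝ) + 1) * δ)
    have hβ0 : 0 ≤ β := by rcases hβ with h0 | h0 <;> [rw [h0]; linarith]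
    have hjR : (2 : ℝ) ≤ j := by exact_mod_cast hj
    have hsq : (1 : ℝ) ≤ (j : ℝ) ^ 2 := by nlinarith
    have h1 : (j : ℝ) ^ 2 * μ ≤ μ := by
      have := mul_le_mul_of_nonpos_right hsq hμ.le
      linarith
    have h2 : 0 ≤ ((j : ℝ) + 1) * δ := by positivity
    have h3 : 0 ≤ ((j : ℝ) + 1) * β := by positivity
    linarith

/-- `sqSubOne_mul_le_of_le` WITHOUT `1 ≤ j₁` (the `j₁ = 0` case: `h` forces `κ > −1`, and `−μ ≤ 0`). [folklore] -/
theorem sqSubOne_mul_le_of_le' {μ κ : ℝ} (hμ : 0 ≤ μ) {j₁ j₂ : ℕ} (hj : j₁ ≤ j₂)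
    (h : (((j₂ : ℝ)) ^ 2 - 1) * μ ≤ ((j₂ : ℝ) + 1) * κ + 1) :
    (((j₁ : ℝ)) ^ 2 - 1) * μ ≤ ((j₁ : ℝ) + 1) * κ + 1 := by
  rcases Nat.eq_zero_or_pos j₁ with h0 | hpos
  · subst h0
    simp only [Nat.cast_zero]
    rcases Nat.eq_zero_or_pos j₂ with h2 | h2
    · subst h2; simpa using h
    · have hj2R : (1 : ℝ) ≤ j₂ := by exact_mod_cast h2
      have hsq : 0 ≤ (((j₂ : ℝ)) ^ 2 - 1) * μ := mul_nonneg (by nlinarith) hμ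
      have hk : 0 ≤ ((j₂ : ℝ) + 1) * κ + 1 := le_trans hsq h
      have hprod : 1 ≤ ((j₂ : ℝ) + 1) * (κ + 1) := by nlinarith
      have hk1 : 0 < κ + 1 := by
        by_contra hc
        rw [not_lt] at hc
        have : ((j₂ : ℝ) + 1) * (κ + 1) ≤ 0 := by nlinarith
        linarith
      nlinarith
  · exact sqSubOne_mul_le_of_le hμ hpos hj h

end Summit.ABC.IUTFork.Repair.RHHullCapacityNecessaryAntiTight

end
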